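import Mathlib
import Literature.NumberTheory.GaloisRepresentations.SGeneralQuadraticFamily
import Literature.NumberTheory.QuadraticForms.QuadraticExtensionPlaces
import Summits.Langlands.Langlands.Theorems.QuadraticWindowHostInducedRepPaneDefs

/-!
# The biquadratic pane tower — sub-stub `stub_memberTower` of the member statement of stub
# `stub_package`, line `one-transparent-pane` (crux
# `Summit.Langlands.Langlands.Theses.QuadraticWindow.HostInducedRep`, item stmt-Langlands-10902)

LOG (wave-3 worker `stub_memberTower`, 2026-08-16).  FACT-FREE; proves the registered signature
`stub_memberTower` verbatim (last declaration).  Setting: `F₀` totally real, `F/F₀` quadratic with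
involution `τ ≠ 1`, `K/F₀` CM quadratic with involution `cK ≠ 1`, and no `F₀`-embedding `F → K`.
Output: types `L`, `F'` with their field / number-field / algebra structures,
`IsScalarTower F₀ F L`, `IsScalarTower F₀ K L`, `IsGalois K L`, `s : L ≃ₐ[F'] L` and
`IsPaneTower τ cK L F' s` (the predicate of `…PaneDefs.lean`: `[L:F] = [L:K] = [L:F'] = 2`,
`s ≠ 1`, `s|_K = cK`, `s|_F = τ`,
`F ∩ K = F₀`, and the PANE property `ComplexEmbedding.IsConj σ s` for every embedding `σ` of `L`
that is not real on `F`).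

Construction (all concrete, Mathlib's `QuadraticAlgebra`):
* `exists_sqrt_generator`, `exists_model` — `F = F₀(α)` with `τ α = -α`, `α² = a ∈ F₀`, `α ∉ F₀`
  (`α = β - τ β`), whence `F ≃ F₀[ω]/(ω² - a) = QuadraticAlgebra F₀ a 0` (`QuadraticAlgebra.lift`,
  injective out of a field between `F₀`-planes) with `τ ↔ (ω ↦ -ω)`;
* `fact_of_isEmpty` — `a` is not a square in `K` (a square root `r` gives `ω ↦ r : F →ₐ[F₀] K`), so
  `L := QuadraticAlgebra K (algebraMap F₀ K a) 0 = K[ω]/(ω² - a)` is a field — a number field,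
  quadratic and Galois over `K` (tree instances `instNumberFieldQuadraticAlgebra`,
  `instIsQuadraticExtensionQuadraticAlgebra` of `SGeneralQuadraticFamily`), an `F`-algebra through
  `e ω ↦ ω`;
* `exists_paneInv` — `s (x + y ω) = cK x - cK y ω`, an `F₀`-automorphism of `L` of order `2`;
  `F' := L^s` (`IntermediateField.fixedField`, `finrank_fixedField_eq_card`);
* `apply_algEquiv_eq_conj` — over a totally real base the involution of a quadratic extension is
  the complex conjugation of every non-real embedding
  (`ComplexEmbedding.exists_comp_symm_eq_of_comp_eq`, `IsTotallyReal.complexEmbedding_isReal`,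
  `QuadraticExtension.algEquiv_eq_one_or_eq`); applied to `σ|_K` (`K` totally complex,
  `IsTotallyComplex.complexEmbedding_not_isReal`) and to `σ|_F` (hypothesis) it gives
  `conj ∘ σ = σ ∘ s` on `K` and on `ω`, hence on `L`;
* `exists_isPaneTower_of_sqrt` assembles, `stub_memberTower` = registered signature.
[folklore]
-/

open NumberField
open Summit.Langlands.Langlands.Theorems.HostInducedRep.GrsExplicitDescent

-- `Summit.Langlands.Langlands.…` (summit = sub-problem name, D-0017 layout) trips `dupNamespace`.
set_option linter.dupNamespace false

noncomputable section

namespace Summit.Langlands.Langlands.Theorems.HostInducedRep.OneTransparentPane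

open Literature.NumberTheory.QuadraticForms

section Inv

variable {F₀ K : Type} [Field F₀] [Field K] [Algebra F₀ K]

/-- Over the tower `F₀ → K → K[ω]`: real part of a base scalar. [folklore] -/
@[simp] theorem algebraMap_base_re (a' : K) (r : F₀) :
    (algebraMap F₀ (QuadraticAlgebra K a' 0) r).re = algebraMap F₀ K r := rfl

/-- Over the tower `F₀ → K → K[ω]`: a base scalar has no `ω`-part. [folklore] -/
@[simp] theorem algebraMap_base_im (a' : K) (r : F₀) :
    (algebraMap F₀ (QuadraticAlgebra K a' 0) r).im = 0 := rfl

/-- **The involution `x + y ω ↦ cK x - cK y ω`** of `K[ω]/(ω² - a')`, for an `F₀`-automorphism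
`cK` of `K` fixing `a'`, exists as an `F₀`-algebra automorphism of Mathlib's
`QuadraticAlgebra K a' 0` (stated as an existence to keep this file definition-free). [folklore] -/
theorem exists_paneInv (cK : K ≃ₐ[F₀] K) (a' : K) (ha : cK a' = a') :
    ∃ s₀ : QuadraticAlgebra K a' 0 ≃ₐ[F₀] QuadraticAlgebra K a' 0,
      ∀ z, s₀ z = ⟨cK z.re, -cK z.im⟩ :=
  ⟨{ toFun := fun z ↦ ⟨cK z.re, -cK z.im⟩
     invFun := fun z ↦ ⟨cK.symm z.re, -cK.symm z.im⟩
     left_inv := fun z ↦ by ext <;> simp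
     right_inv := fun z ↦ by ext <;> simp
     map_mul' := fun z w ↦ by
       ext
       · simp [ha]
       · simp; ring
     map_add' := fun z w ↦ by
       ext
       · simp
       · simp; ring
     commutes' := fun r ↦ by ext <;> simp }, fun _ ↦ rfl⟩

variable {cK : K ≃ₐ[F₀] K} {a' : K} {s₀ : QuadraticAlgebra K a' 0 ≃ₐ[F₀] QuadraticAlgebra K a' 0}
  (hs₀ : ∀ z, s₀ z = ⟨cK z.re, -cK z.im⟩)
include hs₀

/-- The involution restricts to `cK` on `K`. [folklore] -/
theorem paneInv_algebraMap (x : K) :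
    s₀ (algebraMap K (QuadraticAlgebra K a' 0) x) =
      algebraMap K (QuadraticAlgebra K a' 0) (cK x) := by
  rw [hs₀]
  ext <;> simp

/-- The involution has square `1` when `cK` has. [folklore] -/
theorem paneInv_sq (hc : ∀ x : K, cK (cK x) = x) : s₀ ^ 2 = 1 :=
  AlgEquiv.ext fun z ↦ by
    rw [sq, AlgEquiv.mul_apply, AlgEquiv.one_apply, hs₀, hs₀]
    ext <;> simp [hc]

/-- The involution is not `1` (it negates `ω`; characteristic zero). [folklore] -/
theorem paneInv_ne_one [CharZero K] : s₀ ≠ 1 := by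
  intro h
  have h1 := congrArg QuadraticAlgebra.im (hs₀ QuadraticAlgebra.omega)
  rw [h, AlgEquiv.one_apply, QuadraticAlgebra.omega_im, map_one] at h1
  -- `1 = -1` in `K`
  have h2 : (2 : K) = 0 := by linear_combination h1
  exact two_ne_zero h2

omit hs₀

/-- `ω² = a` in `K[ω]/(ω² - a)` over `F₀`, in `QuadraticAlgebra.lift` format. [folklore] -/
theorem omega_pane_mul_self (a : F₀) :
    (QuadraticAlgebra.omega : QuadraticAlgebra K (algebraMap F₀ K a) 0) * QuadraticAlgebra.omega =
      a • (1 : QuadraticAlgebra K (algebraMap F₀ K a) 0) + (0 : F₀) • QuadraticAlgebra.omega := by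
  rw [zero_smul, add_zero, QuadraticAlgebra.omega_mul_omega_eq_mk]
  ext <;> simp [Algebra.smul_def]

end Inv

section Quadratic

variable {F₀ E : Type} [Field F₀] [Field E] [Algebra F₀ E]

/-- **A quadratic extension in characteristic `0` is generated by a square root**: if `τ ≠ 1` is an
`F₀`-automorphism of the quadratic `E/F₀`, some `α` with `τ α = -α` has `α² ∈ F₀` and `α ∉ F₀`
(`α = β - τ β` for any `β` moved by `τ`). [folklore] -/
theorem exists_sqrt_generator [CharZero F₀] [CharZero E] (h2 : Module.finrank F₀ E = 2)
    {τ : E ≃ₐ[F₀] E} (hτ : τ ≠ 1) : ∃ (α : E) (a : F₀), τ α = -α ∧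
      (∀ r : F₀, algebraMap F₀ E r ≠ α) ∧ α ^ 2 = algebraMap F₀ E a := by
  haveI : Algebra.IsQuadraticExtension F₀ E := ⟨h2⟩
  obtain ⟨β, hβ⟩ : ∃ β : E, τ β ≠ β := by
    by_contra h
    push Not at h
    exact hτ (AlgEquiv.ext h)
  have hτα : τ (β - τ β) = -(β - τ β) := by
    rw [map_sub, QuadraticExtension.algEquiv_algEquiv_apply hτ, neg_sub]
  obtain ⟨a, ha⟩ := QuadraticExtension.exists_algebraMap_eq_of_fixed hτ
    (x := (β - τ β) ^ 2) (by rw [map_pow, hτα, neg_sq])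
  refine ⟨β - τ β, a, hτα, fun r hr ↦ ?_, ha.symm⟩
  -- an element of `F₀` with `τ α = -α` vanishes (characteristic zero)
  have h1 : τ (β - τ β) = β - τ β := by rw [← hr, AlgEquiv.commutes]
  rw [hτα] at h1
  have h2 : (2 : E) * (β - τ β) = 0 := by linear_combination -h1
  exact hβ (sub_eq_zero.mp ((mul_eq_zero.mp h2).resolve_left two_ne_zero)).symm

variable {α : E} {a : F₀}

/-- `α² = a` in Mathlib's `QuadraticAlgebra.lift` format. [folklore] -/
theorem sqrt_mul_self (hαa : α ^ 2 = algebraMap F₀ E a) : α * α = a • (1 : E) + (0 : F₀) • α := by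
  rw [zero_smul, add_zero, Algebra.smul_def, mul_one, ← hαa, sq]

/-- If `α² = a` with `α ∉ F₀` then `a` is not a square in `F₀` (the `Fact` making
`QuadraticAlgebra F₀ a 0` a field). [folklore] -/
theorem fact_of_sqrt (hαa : α ^ 2 = algebraMap F₀ E a) (hαF₀ : ∀ r : F₀, algebraMap F₀ E r ≠ α) :
    Fact (∀ r : F₀, r ^ 2 ≠ a + 0 * r) := ⟨fun r hr ↦ by
  rw [zero_mul, add_zero] at hr
  have h : (algebraMap F₀ E r) ^ 2 = α ^ 2 := by rw [← map_pow, hr, hαa]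
  rcases eq_or_eq_neg_of_sq_eq_sq _ _ h with h1 | h1
  · exact hαF₀ r h1
  · exact hαF₀ (-r) (by rw [map_neg, h1, neg_neg])⟩

/-- **`F ≃ F₀[ω]/(ω² - a)`** for a quadratic `F = F₀(α)`, `α² = a`, `α ∉ F₀`: the map `ω ↦ α`
(`QuadraticAlgebra.lift`) is injective out of a field, between `F₀`-planes. [folklore] -/
theorem lift_sqrt_bijective (h2 : Module.finrank F₀ E = 2) (hαa : α ^ 2 = algebraMap F₀ E a)
    (hαF₀ : ∀ r : F₀, algebraMap F₀ E r ≠ α) :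
    Function.Bijective
      (QuadraticAlgebra.lift ⟨α, sqrt_mul_self hαa⟩ : QuadraticAlgebra F₀ a 0 →ₐ[F₀] E) := by
  haveI := fact_of_sqrt hαa hαF₀
  haveI : FiniteDimensional F₀ E := Module.finite_of_finrank_eq_succ h2
  set e₀ : QuadraticAlgebra F₀ a 0 →ₐ[F₀] E := QuadraticAlgebra.lift ⟨α, sqrt_mul_self hαa⟩
  have hinj : Function.Injective e₀ := e₀.toRingHom.injective
  exact ⟨hinj, (e₀.toLinearMap.injective_iff_surjective_of_finrank_eq_finrank
    (by rw [QuadraticAlgebra.finrank_eq_two, h2])).mp hinj⟩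

/-- **Over a totally real base, the involution of a quadratic extension is the complex conjugation
of every non-real embedding**: `ψ (c x) = conj (ψ x)` (the conjugate embedding agrees with `ψ` on
`F₀`, so differs from `ψ` by an automorphism, which is not `1`). [folklore] -/
theorem apply_algEquiv_eq_conj [NumberField F₀] [NumberField E] (hTR : IsTotallyReal F₀)
    (h2 : Module.finrank F₀ E = 2) {c : E ≃ₐ[F₀] E} (hc : c ≠ 1) {ψ : E →+* ℂ}
    (hψ : ¬ ComplexEmbedding.IsReal ψ) (x : E) : ψ (c x) = starRingEnd ℂ (ψ x) := by
  haveI : Algebra.IsQuadraticExtension F₀ E := ⟨h2⟩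
  haveI := hTR
  have hreal : (ComplexEmbedding.conjugate ψ).comp (algebraMap F₀ E) = ψ.comp (algebraMap F₀ E) :=
    IsTotallyReal.complexEmbedding_isReal (ψ.comp (algebraMap F₀ E))
  obtain ⟨σ₀, hσ₀⟩ :=
    ComplexEmbedding.exists_comp_symm_eq_of_comp_eq (k := F₀) (ComplexEmbedding.conjugate ψ) ψ hreal
  have hconj : ∀ y : E, ψ (σ₀ y) = starRingEnd ℂ (ψ y) := fun y ↦ by
    have h := RingHom.congr_fun hσ₀ (σ₀ y)
    change starRingEnd ℂ (ψ (σ₀.symm (σ₀ y))) = ψ (σ₀ y) at h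
    rw [AlgEquiv.symm_apply_apply] at h
    exact h.symm
  have hne : σ₀ ≠ 1 := by
    rintro rfl
    exact hψ (RingHom.ext fun y ↦ by
      rw [ComplexEmbedding.conjugate_coe_eq, ← hconj y, AlgEquiv.one_apply])
  rcases QuadraticExtension.algEquiv_eq_one_or_eq hc σ₀ with h | h
  · exact absurd h hne
  · rw [← h]
    exact hconj x

end Quadratic

section Main

variable {F₀ F K : Type} [Field F₀] [NumberField F₀] [Field F] [NumberField F] [Algebra F₀ F]
  [Field K] [NumberField K] [Algebra F₀ K]

/-- **The pane tower from a square-root generator.**  For `F ≃ F₀[ω]/(ω² - a)` (via `e`, with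
`τ ∘ e = e ∘ (ω ↦ -ω)`) and `K/F₀` CM quadratic with involution `cK`, `a` not a square in `K`:
`L = K[ω]/(ω² - a)`, `F → L` by `e ω ↦ ω`, `s (x + y ω) = cK x - cK y ω`, `F' = L^s`; then
`IsPaneTower τ cK L F' s`. [folklore] -/
theorem exists_isPaneTower_of_sqrt [IsCMField K] (hTR : IsTotallyReal F₀)
    (h2F : Module.finrank F₀ F = 2) {τ : F ≃ₐ[F₀] F} (hτ : τ ≠ 1)
    (h2K : Module.finrank F₀ K = 2) {cK : K ≃ₐ[F₀] K} (hcK : cK ≠ 1) {a : F₀}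
    (e : QuadraticAlgebra F₀ a 0 ≃ₐ[F₀] F)
    (hτe : ∀ z : QuadraticAlgebra F₀ a 0, τ (e z) = e ⟨z.re, -z.im⟩)
    [hK : Fact (∀ r : K, r ^ 2 ≠ algebraMap F₀ K a + 0 * r)] :
    ∃ (L F' : Type) (_ : Field L) (_ : NumberField L) (_ : Field F') (_ : NumberField F')
      (_ : Algebra F₀ L) (_ : Algebra F L) (_ : Algebra K L) (_ : Algebra F' L)
      (_ : IsScalarTower F₀ F L) (_ : IsScalarTower F₀ K L) (_ : IsGalois K L) (s : L ≃ₐ[F'] L),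
      IsPaneTower τ cK L F' s := by
  -- `F → L = K[ω]/(ω² - a)`, `e z ↦ z.re + z.im ω`
  set φ : F →ₐ[F₀] QuadraticAlgebra K (algebraMap F₀ K a) 0 :=
    (QuadraticAlgebra.lift ⟨QuadraticAlgebra.omega, omega_pane_mul_self a⟩).comp e.symm.toAlgHom
    with hφ_def
  have hφe : ∀ z, φ (e z) = ⟨algebraMap F₀ K z.re, algebraMap F₀ K z.im⟩ := fun z ↦ by
    rw [hφ_def, AlgHom.comp_apply]
    change QuadraticAlgebra.lift ⟨QuadraticAlgebra.omega, omega_pane_mul_self a⟩ (e.symm (e z)) = _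
    rw [AlgEquiv.symm_apply_apply, QuadraticAlgebra.lift_apply_apply]
    ext <;> simp [Algebra.smul_def]
  letI algFL : Algebra F (QuadraticAlgebra K (algebraMap F₀ K a) 0) := φ.toRingHom.toAlgebra
  haveI hFL : IsScalarTower F₀ F (QuadraticAlgebra K (algebraMap F₀ K a) 0) :=
    IsScalarTower.of_algebraMap_eq fun x ↦ (φ.commutes x).symm
  have hmapF : ∀ x : F, algebraMap F (QuadraticAlgebra K (algebraMap F₀ K a) 0) x = φ x :=
    fun _ ↦ rfl
  -- the involution `s` and its fixed field `F'`
  haveI : Algebra.IsQuadraticExtension F₀ K := ⟨h2K⟩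
  obtain ⟨s₀, hs₀⟩ := exists_paneInv cK (algebraMap F₀ K a) (cK.commutes a)
  have hs₀1 : s₀ ≠ 1 := paneInv_ne_one hs₀
  have hs₀2 : s₀ ^ 2 = 1 := paneInv_sq hs₀ (QuadraticExtension.algEquiv_algEquiv_apply hcK)
  let F' : IntermediateField F₀ (QuadraticAlgebra K (algebraMap F₀ K a) 0) :=
    IntermediateField.fixedField (Subgroup.zpowers s₀)
  have hfix : ∀ x : F', s₀ (x : QuadraticAlgebra K (algebraMap F₀ K a) 0) = x := fun x ↦
    (IntermediateField.mem_fixedField_iff (Subgroup.zpowers s₀) (x : _)).mp x.2 s₀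
      (Subgroup.mem_zpowers s₀)
  let s : QuadraticAlgebra K (algebraMap F₀ K a) 0 ≃ₐ[F']
      QuadraticAlgebra K (algebraMap F₀ K a) 0 :=
    { (s₀ : QuadraticAlgebra K (algebraMap F₀ K a) 0 ≃+*
        QuadraticAlgebra K (algebraMap F₀ K a) 0) with
      commutes' := hfix }
  have hs : ∀ x, s x = s₀ x := fun _ ↦ rfl
  -- degrees
  have hKL : Module.finrank K (QuadraticAlgebra K (algebraMap F₀ K a) 0) = 2 :=
    QuadraticAlgebra.finrank_eq_two _ _
  have h4 : Module.finrank F₀ (QuadraticAlgebra K (algebraMap F₀ K a) 0) = 4 := by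
    rw [← Module.finrank_mul_finrank F₀ K (QuadraticAlgebra K (algebraMap F₀ K a) 0), h2K, hKL]
  haveI : FiniteDimensional F₀ (QuadraticAlgebra K (algebraMap F₀ K a) 0) :=
    Module.finite_of_finrank_eq_succ h4
  have hFL2 : Module.finrank F (QuadraticAlgebra K (algebraMap F₀ K a) 0) = 2 := by
    have h := Module.finrank_mul_finrank F₀ F (QuadraticAlgebra K (algebraMap F₀ K a) 0)
    rw [h4, h2F] at h
    omega
  have hF'L : Module.finrank F' (QuadraticAlgebra K (algebraMap F₀ K a) 0) = 2 := by
    change Module.finrank (IntermediateField.fixedField (Subgroup.zpowers s₀)) _ = 2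
    rw [IntermediateField.finrank_fixedField_eq_card, Nat.card_zpowers, orderOf_eq_prime hs₀2 hs₀1]
  refine ⟨QuadraticAlgebra K (algebraMap F₀ K a) 0, F', inferInstance, inferInstance, inferInstance,
    inferInstance, inferInstance, algFL, inferInstance, inferInstance, hFL, inferInstance,
    inferInstance, s, hFL2, hKL, hF'L, ?_, ?_, ?_, ?_, ?_⟩
  · -- `s ≠ 1`
    intro h
    exact hs₀1 (AlgEquiv.ext fun x ↦ by rw [← hs, h, AlgEquiv.one_apply, AlgEquiv.one_apply])
  · -- `s|_K = cK`
    intro x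
    rw [hs, paneInv_algebraMap hs₀]
  · -- `s|_F = τ`
    intro x
    obtain ⟨z, rfl⟩ := e.surjective x
    rw [hmapF, hmapF, hτe, hφe, hφe, hs, hs₀]
    ext <;> simp
  · -- `F ∩ K = F₀`
    intro x y hxy
    obtain ⟨z, rfl⟩ := e.surjective x
    rw [hmapF, hφe, QuadraticAlgebra.algebraMap_eq] at hxy
    have him : algebraMap F₀ K z.im = 0 := by
      have := congrArg QuadraticAlgebra.im hxy
      simpa using this
    refine ⟨z.re, ?_⟩
    have hz : z.im = 0 := (algebraMap F₀ K).injective (by rw [him, map_zero])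
    have hz' : z = algebraMap F₀ (QuadraticAlgebra F₀ a 0) z.re := by ext <;> simp [hz]
    conv_lhs => rw [hz']
    exact e.commutes z.re
  · -- the pane property
    intro σ hσ
    have hKconj : ∀ x : K, σ (algebraMap K _ (cK x)) = starRingEnd ℂ (σ (algebraMap K _ x)) :=
      fun x ↦ apply_algEquiv_eq_conj hTR h2K hcK (ψ := σ.comp (algebraMap K _))
        (IsTotallyComplex.complexEmbedding_not_isReal _) x
    have hφα : φ (e QuadraticAlgebra.omega) = QuadraticAlgebra.omega := by
      rw [hφe]; ext <;> simp
    have hωconj : starRingEnd ℂ (σ QuadraticAlgebra.omega) = -σ QuadraticAlgebra.omega := by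
      have h := apply_algEquiv_eq_conj hTR h2F hτ (ψ := σ.comp (algebraMap F _)) hσ
        (e QuadraticAlgebra.omega)
      have hneg : τ (e QuadraticAlgebra.omega) = -e QuadraticAlgebra.omega := by
        rw [hτe, ← map_neg]; congr 1; ext <;> simp
      rw [RingHom.comp_apply, RingHom.comp_apply, hmapF, hmapF, hneg, map_neg, map_neg, hφα] at h
      exact h.symm
    refine RingHom.ext fun x ↦ ?_
    rw [ComplexEmbedding.conjugate_coe_eq, RingHom.comp_apply]
    change starRingEnd ℂ (σ x) = σ (s x)
    have hx : x = algebraMap K _ x.re + algebraMap K _ x.im * QuadraticAlgebra.omega := by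
      conv_lhs => rw [← QuadraticAlgebra.mk_eta x, QuadraticAlgebra.mk_eq_add_smul_omega,
        Algebra.smul_def]
    have hsx : s x =
        algebraMap K _ (cK x.re) + algebraMap K _ (-cK x.im) * QuadraticAlgebra.omega := by
      rw [hs, hs₀, QuadraticAlgebra.mk_eq_add_smul_omega, Algebra.smul_def]
    rw [hsx]
    conv_lhs => rw [hx]
    simp only [map_add, map_mul, map_neg, hKconj, hωconj]
    ring

/-- **`F ≃ F₀[ω]/(ω² - a)` with `τ ↔ (ω ↦ -ω)`** for a quadratic `F/F₀` with involution `τ`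
(characteristic zero). [folklore] -/
theorem exists_model (h2F : Module.finrank F₀ F = 2) {τ : F ≃ₐ[F₀] F} (hτ : τ ≠ 1) :
    ∃ (a : F₀) (e : QuadraticAlgebra F₀ a 0 ≃ₐ[F₀] F),
      ∀ z : QuadraticAlgebra F₀ a 0, τ (e z) = e ⟨z.re, -z.im⟩ := by
  obtain ⟨α, a, hτα, hαF₀, hαa⟩ := exists_sqrt_generator h2F hτ
  refine ⟨a, AlgEquiv.ofBijective _ (lift_sqrt_bijective h2F hαa hαF₀), fun z ↦ ?_⟩
  simp only [AlgEquiv.ofBijective_apply, QuadraticAlgebra.lift_apply_apply, Algebra.smul_def,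
    map_add, map_mul, map_one, map_neg, AlgEquiv.commutes, hτα]
  ring

omit [NumberField F₀] [NumberField F] [NumberField K] in
/-- **`a` is not a square in `K`** when `F ≃ F₀[ω]/(ω² - a)` admits no `F₀`-embedding into `K`
(a square root `r` would give `ω ↦ r`). [folklore] -/
theorem fact_of_isEmpty {a : F₀} (e : QuadraticAlgebra F₀ a 0 ≃ₐ[F₀] F) (h : IsEmpty (F →ₐ[F₀] K)) :
    Fact (∀ r : K, r ^ 2 ≠ algebraMap F₀ K a + 0 * r) :=
  ⟨fun r hr ↦ h.false ((QuadraticAlgebra.lift ⟨r, by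
    rw [zero_smul, add_zero, Algebra.smul_def, mul_one, ← sq, hr, zero_mul, add_zero]⟩).comp
      e.symm.toAlgHom)⟩

end Main

/-- **Sub-stub TOWER (`stub_memberTower`) of the member statement of line `one-transparent-pane`.**
For `F/F₀` quadratic over the totally real `F₀` (involution `τ`) and a CM quadratic `K/F₀`
(involution `cK`) admitting no `F₀`-embedding of `F`: the biquadratic field `L = F·K` exists as a
TYPE with its algebra structures over `F₀, F, K`, a fourth field `F'` with `L/F'` quadratic of
involution `s = τ̃ c̃`, and `IsPaneTower` holds (degrees, restrictions of `s`, `F ∩ K = F₀`, and the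
pane property: `s` is complex conjugation under every embedding of `L` that is complex on `F`).
Construction: `F ≃ F₀[ω]/(ω² - a)` (`exists_model`), `L = K[ω]/(ω² - a)` (a field: `a` is not a
square in `K`, `fact_of_isEmpty`), `s (x + y ω) = cK x - cK y ω`, `F' = L^s`
(`exists_isPaneTower_of_sqrt`). [folklore] -/
theorem stub_memberTower : ∀ (F₀ F : Type) [Field F₀] [NumberField F₀] [Field F] [NumberField F] [Algebra F₀ F] (τ : F ≃ₐ[F₀] F), IsTotallyReal F₀ → Module.finrank F₀ F = 2 → τ ≠ 1 → ∀ (K : Type) [Field K] [NumberField K] [Algebra F₀ K] [IsCMField K] (cK : K ≃ₐ[F₀] K), Module.finrank F₀ K = 2 → cK ≠ 1 → IsEmpty (F →ₐ[F₀] K) → ∃ (L F' : Type) (_ : Field L) (_ : NumberField L) (_ : Field F') (_ : NumberField F') (_ : Algebra F₀ L) (_ : Algebra F L) (_ : Algebra K L) (_ : Algebra F' L) (_ : IsScalarTower F₀ F L) (_ : IsScalarTower F₀ K L) (_ : IsGalois K L) (s : L ≃ₐ[F'] L), IsPaneTower τ cK L F' s := by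
  intro F₀ F _ _ _ _ _ τ hTR h2F hτ K _ _ _ _ cK h2K hcK hemp
  obtain ⟨a, e, hτe⟩ := exists_model h2F hτ
  haveI := fact_of_isEmpty (K := K) e hemp
  exact exists_isPaneTower_of_sqrt hTR h2F hτ h2K hcK e hτe


end Summit.Langlands.Langlands.Theorems.HostInducedRep.OneTransparentPane

end
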